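import Literature.MathematicalPhysics.QuantumLattice.GrassmannEffectiveActionRepresentation
import Literature.MathematicalPhysics.QuantumLattice.SectorisedKernelNormExtraction
import HarnessLib

/-!
# The sector-field substitution of the Hubbard torus: `ψ_{x,σ,ω} ↦ (βL²)⁻¹ Σ_k F_ω(k) e^{is_c k·x} ψ̂_{k,σ}`

Topic `MathematicalPhysics/QuantumLattice`; the model-side companion of `GrassmannEffectiveActionRepresentation.lean`
(the single-scale step read through a substitution `f` and an analysis map `g`) for the momentum-labelled
Grassmann algebra `HubbardGrassmann L M` and the vocabulary of `SectorisedKernelNorm.lean` (sector fields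
`psiSector`, sectorised kernels `sectorisedKernel`, the norm `hubbardSectorKernelNorm`) — Benfatto–Giuliani–Mastropietro
2006, §2.5 (2.48) and §2.7 (2.70)–(2.71).  Two explicit matrices:

* **`sectorSubMatrix β F`** `: Matrix (HubbardFieldIdx L M) (SpaceTimeIdx L M × SectorLeg N) ℂ` — the SUBSTITUTION
  writing an auxiliary position-space sector field `ψ'_{(x, ((ω,σ),c))}` in terms of the momentum fields:
  `map (toLin' (sectorSubMatrix β F)) (gen (x, ℓ)) = psiSector β F c x σ ω` (`map_sectorSub_gen`);
* **`sectorAnalysisMatrix β F`** `: Matrix (SpaceTimeIdx L M × SectorLeg N) (HubbardFieldIdx L M) ℂ` — the ANALYSIS map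
  `ψ̂^c_{k,σ} ↦ Σ_{x,ω} F_ω(k) e^{-is_c k·x} ψ'_{(x,((ω,σ),c))}` whose kernels are BGM's sectorised kernels:
  `kernel (map (toLin' (sectorAnalysisMatrix β F)) W) m Y = sectorisedKernel β F W m (ℓ ∘ Y) (x ∘ Y)`
  (`kernel_map_sectorAnalysis`), so that `hubbardSectorKernelNorm β F A W ≤ kernelNorm ε (kernel (map … W))`
  (`hubbardSectorKernelNorm_le_kernelNorm_map`);
* the pulled-back covariance `Sᵀ C S` between the auxiliary fields (`sectorSub_pullback_apply`: the sectorised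
  position-space propagators (2.66)–(2.67) of any momentum-space covariance `C`) and the overlap kernel of the
  composite `E S` (`sectorAnalysis_mul_sectorSub_apply`: `[σ, c equal] (βL²)⁻¹ Σ_k F'_{ω'}(k) F_ω(k) e^{-is_c k·(y-x)}`),
  whose row and column sums are the multiplier costs `(cr, cc)` of the representation theorem;

and the generic lemmas they rest on: `map_genProd_eq_sum`, **`map_presented`** (presentations push forward by
the tensor powers of the substitution matrix), `pinnedSum_prod_eq_sectorLegSum_univ`,
`sectorisedKernelNorm_le_kernelNorm_prod`, `kernelNorm_prod_le_sectorisedKernelNorm_univ` (the sectorised norm of a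
family on labels `S` and positions `P` versus Salmhofer's norm on the product labels `P × S`), `sum_fieldIdx_ite`,
`sum_fieldIdx_tuple_eq` (sums over field labels with spin and charge prescribed).

Everything is proved; the two matrices are the only definitions; no named facts.

## Sources

G. Benfatto, A. Giuliani, V. Mastropietro, Ann. Henri Poincaré 7 (2006) 809–898 = arXiv:cond-mat/0507686, §2.1
(2.5), §2.5 (2.44)–(2.48), §2.7 (2.66)–(2.71a), §2.8 (2.76)–(2.82) [`BenfattoGiulianiMastropietro2006`]; M. Salmhofer,
*Renormalization* (1999), App. B.5.5 [`Salmhofer1999`].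
-/

noncomputable section

namespace Literature.MathematicalPhysics.QuantumLattice

open GrassmannAlgebra Finset Literature.Probability.LatticeModels

/-! ### Generic: presentations under substitutions; product labels versus (label, position) families -/

section Generic

variable (R : Type*) [CommRing R] {Γ Γ' : Type*} [Fintype Γ] [DecidableEq Γ] [Fintype Γ'] [DecidableEq Γ']

/-- **Ordered monomials push forward multilinearly**:
`map f (ψ(Y_0)⋯ψ(Y_{m-1})) = Σ_{X'} (∏ᵢ M(X'ᵢ, Yᵢ)) ψ'(X'_0)⋯ψ'(X'_{m-1})`. [folklore] -/
theorem map_genProd_eq_sum (f : (Γ → R) →ₗ[R] (Γ' → R)) : ∀ {m : ℕ} (Y : Fin m → Γ),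
    ExteriorAlgebra.map f (genProd R Y) = ∑ X' : Fin m → Γ', (∏ i, LinearMap.toMatrix' f (X' i) (Y i)) • genProd R X'
  | 0, Y => by simp [genProd_zero]
  | m + 1, Y => by
    rw [genProd_succ, map_mul, map_gen_eq_sum, map_genProd_eq_sum f (Fin.tail Y), sum_mul,
      ← (Fin.consEquiv fun _ => Γ').sum_comp, Fintype.sum_prod_type]
    refine sum_congr rfl fun x' _ => ?_
    rw [mul_sum]
    refine sum_congr rfl fun X _ => ?_
    rw [Algebra.smul_mul_assoc, Algebra.mul_smul_comm, smul_smul]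
    simp only [Fin.consEquiv, Equiv.coe_fn_mk, Fin.prod_univ_succ, Fin.cons_zero, Fin.cons_succ,
      genProd_succ R (Fin.cons x' X : Fin (m + 1) → Γ'), Fin.tail_cons]
    rfl

/-- **Presentations push forward by the tensor powers of the substitution matrix**:
`map f (presented φ) = presented (X' ↦ Σ_Y (∏ᵢ M(X'ᵢ, Yᵢ)) φ(Y))`. [folklore] -/
theorem map_presented (f : (Γ → R) →ₗ[R] (Γ' → R)) {m : ℕ} (φ : (Fin m → Γ) → R) :
    ExteriorAlgebra.map f (presented R φ) =
      presented R (fun X' : Fin m → Γ' => ∑ Y : Fin m → Γ, (∏ i, LinearMap.toMatrix' f (X' i) (Y i)) * φ Y) := by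
  simp only [presented, map_sum, map_smul, map_genProd_eq_sum, smul_sum, smul_smul, sum_smul]
  rw [sum_comm]
  exact sum_congr rfl fun X' _ => sum_congr rfl fun Y _ => by rw [mul_comm]

variable {𝕜 : Type*} [RCLike 𝕜] {S P : Type*} [Fintype S] [DecidableEq S] [Fintype P] [DecidableEq P]

omit [Fintype Γ] [DecidableEq Γ] [Fintype Γ'] [DecidableEq Γ'] in
/-- **Pinned sums on product labels are leg sums without constraint**: for a family `W_Ω(X)` of kernels with
discrete labels in `S` and positions in `P`, the pinned sum of the kernel `Y ↦ W_{ℓ∘Y}(x∘Y)` on the product labels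
`P × S` at `Y_p = (x, s)` is `sectorLegSum ε univ W p s x`. [folklore] -/
theorem pinnedSum_prod_eq_sectorLegSum_univ (ε : ℝ) {m : ℕ} (W : (Fin (m + 1) → S) → (Fin (m + 1) → P) → 𝕜)
    (p : Fin (m + 1)) (x : P) (s : S) :
    ε ^ m * ∑ Y ∈ univ.filter (fun Y : Fin (m + 1) → P × S => Y p = (x, s)),
        ‖W (fun i => (Y i).2) (fun i => (Y i).1)‖ = sectorLegSum ε univ W p s x := by
  rw [sectorLegSum_def, ← mul_sum]
  congr 1
  rw [sum_filter, sum_filter, ← (Equiv.arrowProdEquivProdArrow (Fin (m + 1)) (fun _ => P) (fun _ => S)).symm.sum_comp,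
    Fintype.sum_prod_type, sum_comm]
  refine sum_congr rfl fun Ω _ => ?_
  split_ifs with hΩ
  · rw [sum_filter]
    refine sum_congr rfl fun X _ => ?_
    simp [Equiv.arrowProdEquivProdArrow, Prod.ext_iff, hΩ]
  · refine sum_eq_zero fun X _ => ?_
    rw [if_neg]
    simp [Equiv.arrowProdEquivProdArrow, Prod.ext_iff, hΩ]

omit [Fintype Γ] [DecidableEq Γ] [Fintype Γ'] [DecidableEq Γ'] in
/-- **The constrained sectorised norm is dominated by Salmhofer's norm on the product labels.** [folklore] -/
theorem sectorisedKernelNorm_le_kernelNorm_prod {ε : ℝ} (hε : 0 ≤ ε) {m : ℕ} (A : Finset (Fin (m + 1) → S))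
    (W : (Fin (m + 1) → S) → (Fin (m + 1) → P) → 𝕜) :
    sectorisedKernelNorm ε (m + 1) A W ≤
      kernelNorm ε (m + 1) (fun Y : Fin (m + 1) → P × S => W (fun i => (Y i).2) (fun i => (Y i).1)) :=
  sectorisedKernelNorm_le_of_forall_le (kernelNorm_nonneg hε _ _) fun p s x =>
    (sectorLegSum_mono hε (subset_univ A) W p s x).trans (by
      rw [← pinnedSum_prod_eq_sectorLegSum_univ]
      exact pinnedSum_le_kernelNorm ε m _ p (x, s))

omit [Fintype Γ] [DecidableEq Γ] [Fintype Γ'] [DecidableEq Γ'] in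
/-- **Salmhofer's norm on the product labels is the unconstrained sectorised norm** (the reverse inequality).
[folklore] -/
theorem kernelNorm_prod_le_sectorisedKernelNorm_univ {ε : ℝ} (hε : 0 ≤ ε) {m : ℕ}
    (W : (Fin (m + 1) → S) → (Fin (m + 1) → P) → 𝕜) :
    kernelNorm ε (m + 1) (fun Y : Fin (m + 1) → P × S => W (fun i => (Y i).2) (fun i => (Y i).1)) ≤
      sectorisedKernelNorm ε (m + 1) univ W :=
  kernelNorm_succ_le_of_forall ε m _ (sectorisedKernelNorm_nonneg hε _ _ _) fun p y => by
    obtain ⟨x, s⟩ := y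
    rw [pinnedSum_prod_eq_sectorLegSum_univ]
    exact sectorLegSum_le_sectorisedKernelNorm ε univ W p s x

end Generic

/-! ### Sums over field labels with spin and charge prescribed -/

section FieldIdx

variable {L M : ℕ} [NeZero L]

/-- `Σ_{((k,σ'),c')} [σ' = σ ∧ c' = c] g = Σ_k g((k,σ),c)`. [folklore] -/
theorem sum_fieldIdx_ite {A : Type*} [AddCommMonoid A] (σ c : Fin 2) (g : HubbardFieldIdx L M → A) :
    ∑ K : HubbardFieldIdx L M, (if K.1.2 = σ ∧ K.2 = c then g K else 0) = ∑ k : FreqMomentum L M, g ((k, σ), c) := by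
  rw [Fintype.sum_prod_type, Fintype.sum_prod_type]
  refine sum_congr rfl fun k _ => ?_
  rw [Finset.sum_eq_single_of_mem σ (mem_univ _) fun σ' _ hσ' => sum_eq_zero fun c' _ => if_neg fun h => hσ' h.1,
    Finset.sum_eq_single_of_mem c (mem_univ _) fun c' _ hc' => if_neg fun h => hc' h.2, if_pos ⟨rfl, rfl⟩]

/-- Sums of functions of label tuples vanishing unless every leg has the prescribed spin and charge reduce to sums
over momentum tuples. [folklore] -/
theorem sum_fieldIdx_tuple_eq {A : Type*} [AddCommMonoid A] {m : ℕ} (σ c : Fin m → Fin 2)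
    (g : (Fin m → HubbardFieldIdx L M) → A) (hg : ∀ K, (∃ i, ¬((K i).1.2 = σ i ∧ (K i).2 = c i)) → g K = 0) :
    ∑ K, g K = ∑ k : Fin m → FreqMomentum L M, g (fun i => ((k i, σ i), c i)) := by
  classical
  set emb : (Fin m → FreqMomentum L M) → (Fin m → HubbardFieldIdx L M) := fun k i => ((k i, σ i), c i) with hemb
  have hinj : Function.Injective emb := fun k k' h => funext fun i => by
    have := congrFun h i
    simp only [hemb, Prod.mk.injEq] at this
    exact this.1.1
  rw [← sum_image (f := g) fun k _ k' _ h => hinj h]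
  symm
  refine sum_subset (subset_univ _) fun K _ hK => hg K ?_
  by_contra hall
  push Not at hall
  refine hK (mem_image.2 ⟨fun i => (K i).1.1, mem_univ _, funext fun i => ?_⟩)
  obtain ⟨h1, h2⟩ := hall i
  simp only [hemb]
  rw [← h1, ← h2]

end FieldIdx

/-! ### The two matrices -/

section Matrices

variable (L M : ℕ) [NeZero L] {N : ℕ}

/-- **The sector-field substitution matrix**: the auxiliary generator `ψ'_{(x, ((ω,σ),c))}` (a position-space
sector field of the family `F`) in terms of the momentum fields, `ψ'_{(x,((ω,σ),c))} ↦ Σ_k (βL²)⁻¹ F_ω(k)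
conj(e^{-is_c k·x}) ψ̂^c_{k,σ}` (BGM 2006, (2.48) with (2.5)). [cite: BenfattoGiulianiMastropietro2006, §2.5 (2.48)] -/
def sectorSubMatrix (β : ℝ) (F : Fin N → FreqMomentum L M → ℂ) :
    Matrix (HubbardFieldIdx L M) (SpaceTimeIdx L M × SectorLeg N) ℂ :=
  Matrix.of fun K Y => if K.1.2 = Y.2.1.2 ∧ K.2 = Y.2.2 then
    (((1 / (β * (L : ℝ) ^ 2) : ℝ) : ℂ) * (F Y.2.1.1 K.1.1 * (starRingEnd ℂ) (hubbardPlaneWave L M β Y.2.2 K.1.1 Y.1)))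
    else 0

/-- **The sector analysis matrix**: `ψ̂^c_{k,σ} ↦ Σ_{x,ω} F_ω(k) e^{-is_c k·x} ψ'_{(x,((ω,σ),c))}`, the map whose
kernels are the sectorised position-space kernels of BGM 2006, (2.70)–(2.71). [cite: BenfattoGiulianiMastropietro2006, §2.7 (2.70)] -/
def sectorAnalysisMatrix (β : ℝ) (F : Fin N → FreqMomentum L M → ℂ) :
    Matrix (SpaceTimeIdx L M × SectorLeg N) (HubbardFieldIdx L M) ℂ :=
  Matrix.of fun Y K => if K.1.2 = Y.2.1.2 ∧ K.2 = Y.2.2 then F Y.2.1.1 K.1.1 * hubbardPlaneWave L M β Y.2.2 K.1.1 Y.1 else 0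

variable {L M}

omit [NeZero L] in
/-- Unfolding `sectorSubMatrix`. [folklore] -/
theorem sectorSubMatrix_apply (β : ℝ) (F : Fin N → FreqMomentum L M → ℂ) (K : HubbardFieldIdx L M)
    (Y : SpaceTimeIdx L M × SectorLeg N) :
    sectorSubMatrix L M β F K Y = if K.1.2 = Y.2.1.2 ∧ K.2 = Y.2.2 then
      (((1 / (β * (L : ℝ) ^ 2) : ℝ) : ℂ) * (F Y.2.1.1 K.1.1 * (starRingEnd ℂ) (hubbardPlaneWave L M β Y.2.2 K.1.1 Y.1)))
      else 0 := rfl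

omit [NeZero L] in
/-- Unfolding `sectorAnalysisMatrix`. [folklore] -/
theorem sectorAnalysisMatrix_apply (β : ℝ) (F : Fin N → FreqMomentum L M → ℂ) (Y : SpaceTimeIdx L M × SectorLeg N)
    (K : HubbardFieldIdx L M) :
    sectorAnalysisMatrix L M β F Y K =
      if K.1.2 = Y.2.1.2 ∧ K.2 = Y.2.2 then F Y.2.1.1 K.1.1 * hubbardPlaneWave L M β Y.2.2 K.1.1 Y.1 else 0 := rfl

/-- **The substitution realises the sector fields**: `map (toLin' S) (ψ'_{(x,((ω,σ),c))}) = psiSector β F c x σ ω`.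
[cite: BenfattoGiulianiMastropietro2006, §2.5 (2.48)] -/
theorem map_sectorSub_gen (β : ℝ) (F : Fin N → FreqMomentum L M → ℂ) (Y : SpaceTimeIdx L M × SectorLeg N) :
    ExteriorAlgebra.map (Matrix.toLin' (sectorSubMatrix L M β F)) (gen ℂ Y) = psiSector L M β F Y.2.2 Y.1 Y.2.1.2 Y.2.1.1 := by
  rw [map_gen_eq_sum, LinearMap.toMatrix'_toLin', psiSector]
  simp only [sectorSubMatrix_apply, ite_smul, zero_smul]
  rw [sum_fieldIdx_ite]

/-- **The kernels of the analysis map are the sectorised kernels**: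
`kernel (map (toLin' E) W) m Y = sectorisedKernel β F W m (ℓ ∘ Y) (x ∘ Y)`. [cite: BenfattoGiulianiMastropietro2006, §2.7 (2.70)] -/
theorem kernel_map_sectorAnalysis (β : ℝ) (F : Fin N → FreqMomentum L M → ℂ) (W : HubbardGrassmann L M) (m : ℕ)
    (Y : Fin m → SpaceTimeIdx L M × SectorLeg N) :
    kernel ℂ (ExteriorAlgebra.map (Matrix.toLin' (sectorAnalysisMatrix L M β F)) W) m Y =
      sectorisedKernel L M β F W m (fun i => (Y i).2) (fun i => (Y i).1) := by
  rw [kernel_map, LinearMap.toMatrix'_toLin', sectorisedKernel_def,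
    sum_fieldIdx_tuple_eq (fun i => (Y i).2.1.2) (fun i => (Y i).2.2)]
  · refine sum_congr rfl fun k _ => ?_
    simp only [sectorAnalysisMatrix_apply, and_self, if_true]
  · rintro K ⟨i, hi⟩
    rw [prod_eq_zero (mem_univ i) (by rw [sectorAnalysisMatrix_apply, if_neg hi]), zero_mul]

/-- **The sectorised norm of `W` is dominated by Salmhofer's norm of the analysed polynomial**:
`hubbardSectorKernelNorm β F A W ≤ kernelNorm ε_x (m+1) (kernel (map (toLin' E) W) (m+1))` for every constraint `A`.
[cite: BenfattoGiulianiMastropietro2006, §2.8 (2.76)] -/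
theorem hubbardSectorKernelNorm_le_kernelNorm_map {β : ℝ} (hβ : 0 ≤ β) (F : Fin N → FreqMomentum L M → ℂ) {m : ℕ}
    (A : Finset (Fin (m + 1) → SectorLeg N)) (W : HubbardGrassmann L M) :
    hubbardSectorKernelNorm L M β F A W ≤
      kernelNorm (imagTimeWeight β M) (m + 1)
        (kernel ℂ (ExteriorAlgebra.map (Matrix.toLin' (sectorAnalysisMatrix L M β F)) W) (m + 1)) := by
  rw [hubbardSectorKernelNorm_def]
  refine (sectorisedKernelNorm_le_kernelNorm_prod (imagTimeWeight_nonneg hβ M) A _).trans (le_of_eq ?_)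
  exact congrArg _ (funext fun Y => (kernel_map_sectorAnalysis β F W (m + 1) Y).symm)

/-- **The pulled-back covariance of the auxiliary sector fields** (the sectorised position-space propagators,
BGM 2006, (2.66)–(2.67), of an arbitrary momentum-space covariance `C`):
`(Sᵀ C S)((x,ℓ),(y,ℓ')) = Σ_{k,k'} a_ℓ(k; x) C(((k,σ),c),((k',σ'),c')) a_{ℓ'}(k'; y)`, `a_ℓ(k;x) = (βL²)⁻¹ F_ω(k) conj(e^{-is_c k·x})`.
[cite: BenfattoGiulianiMastropietro2006, §2.7 (2.66)] -/
theorem sectorSub_pullback_apply (β : ℝ) (F : Fin N → FreqMomentum L M → ℂ)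
    (C : Matrix (HubbardFieldIdx L M) (HubbardFieldIdx L M) ℂ) (Y Y' : SpaceTimeIdx L M × SectorLeg N) :
    ((sectorSubMatrix L M β F).transpose * C * sectorSubMatrix L M β F) Y Y' =
      ∑ k : FreqMomentum L M, ∑ k' : FreqMomentum L M,
        (((1 / (β * (L : ℝ) ^ 2) : ℝ) : ℂ) * (F Y.2.1.1 k * (starRingEnd ℂ) (hubbardPlaneWave L M β Y.2.2 k Y.1))) *
          C ((k, Y.2.1.2), Y.2.2) ((k', Y'.2.1.2), Y'.2.2) *
        (((1 / (β * (L : ℝ) ^ 2) : ℝ) : ℂ) * (F Y'.2.1.1 k' * (starRingEnd ℂ) (hubbardPlaneWave L M β Y'.2.2 k' Y'.1))) := by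
  rw [Matrix.mul_apply]
  -- the outer sum over `K'`
  have h1 : ∀ K' : HubbardFieldIdx L M, ((sectorSubMatrix L M β F).transpose * C) Y K' * sectorSubMatrix L M β F K' Y' =
      if K'.1.2 = Y'.2.1.2 ∧ K'.2 = Y'.2.2 then ((sectorSubMatrix L M β F).transpose * C) Y K' *
        (((1 / (β * (L : ℝ) ^ 2) : ℝ) : ℂ) * (F Y'.2.1.1 K'.1.1 * (starRingEnd ℂ) (hubbardPlaneWave L M β Y'.2.2 K'.1.1 Y'.1)))
        else 0 := by
    intro K'
    rw [sectorSubMatrix_apply]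
    split_ifs <;> simp
  simp_rw [h1]
  rw [sum_fieldIdx_ite, sum_comm]
  refine sum_congr rfl fun k' _ => ?_
  -- the inner sum over `K`
  rw [Matrix.mul_apply]
  have h2 : ∀ K : HubbardFieldIdx L M, (sectorSubMatrix L M β F).transpose Y K * C K ((k', Y'.2.1.2), Y'.2.2) =
      if K.1.2 = Y.2.1.2 ∧ K.2 = Y.2.2 then
        (((1 / (β * (L : ℝ) ^ 2) : ℝ) : ℂ) * (F Y.2.1.1 K.1.1 * (starRingEnd ℂ) (hubbardPlaneWave L M β Y.2.2 K.1.1 Y.1))) *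
          C K ((k', Y'.2.1.2), Y'.2.2) else 0 := by
    intro K
    rw [Matrix.transpose_apply, sectorSubMatrix_apply]
    split_ifs <;> simp
  simp_rw [h2]
  rw [sum_fieldIdx_ite, sum_mul]

/-- **The overlap kernel of analysis after substitution**: `(E' S)((y,ℓ'),(x,ℓ)) = [σ' = σ ∧ c' = c] Σ_k F'_{ω'}(k) e^{-is_c k·y}
(βL²)⁻¹ F_ω(k) conj(e^{-is_c k·x})` — its row and column sums of norms are the multiplier costs `(cr, cc)` of
`kernelNorm_kernel_map_effAction_le` (BGM 2006, (2.71a)). [cite: BenfattoGiulianiMastropietro2006, §2.7 (2.71)] -/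
theorem sectorAnalysis_mul_sectorSub_apply {N' : ℕ} (β : ℝ) (F' : Fin N' → FreqMomentum L M → ℂ)
    (F : Fin N → FreqMomentum L M → ℂ) (Y' : SpaceTimeIdx L M × SectorLeg N') (Y : SpaceTimeIdx L M × SectorLeg N) :
    (sectorAnalysisMatrix L M β F' * sectorSubMatrix L M β F) Y' Y =
      if Y.2.1.2 = Y'.2.1.2 ∧ Y.2.2 = Y'.2.2 then
        ∑ k : FreqMomentum L M, F' Y'.2.1.1 k * hubbardPlaneWave L M β Y'.2.2 k Y'.1 *
          ((((1 / (β * (L : ℝ) ^ 2) : ℝ) : ℂ) * (F Y.2.1.1 k * (starRingEnd ℂ) (hubbardPlaneWave L M β Y.2.2 k Y.1))))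
        else 0 := by
  rw [Matrix.mul_apply]
  have h1 : ∀ K : HubbardFieldIdx L M, sectorAnalysisMatrix L M β F' Y' K * sectorSubMatrix L M β F K Y =
      if K.1.2 = Y'.2.1.2 ∧ K.2 = Y'.2.2 then
        (if Y.2.1.2 = Y'.2.1.2 ∧ Y.2.2 = Y'.2.2 then F' Y'.2.1.1 K.1.1 * hubbardPlaneWave L M β Y'.2.2 K.1.1 Y'.1 *
          ((((1 / (β * (L : ℝ) ^ 2) : ℝ) : ℂ) * (F Y.2.1.1 K.1.1 * (starRingEnd ℂ) (hubbardPlaneWave L M β Y.2.2 K.1.1 Y.1))))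
          else 0) else 0 := by
    intro K
    rw [sectorAnalysisMatrix_apply, sectorSubMatrix_apply]
    by_cases hK : K.1.2 = Y'.2.1.2 ∧ K.2 = Y'.2.2
    · rw [if_pos hK, if_pos hK]
      by_cases hY : Y.2.1.2 = Y'.2.1.2 ∧ Y.2.2 = Y'.2.2
      · rw [if_pos hY, if_pos ⟨hK.1.trans hY.1.symm, hK.2.trans hY.2.symm⟩]
      · rw [if_neg hY, if_neg (fun h => hY ⟨h.1.symm.trans hK.1, h.2.symm.trans hK.2⟩), mul_zero]
    · rw [if_neg hK, if_neg hK, zero_mul]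
  simp_rw [h1]
  rw [sum_fieldIdx_ite]
  split_ifs with hY
  · rfl
  · exact sum_const_zero

end Matrices

end Literature.MathematicalPhysics.QuantumLattice
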